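import Summits.QuantumFields.YangMills.Theorems.AlphaInputsT3ACv3CovLinAvgFrame
import Literature.MathematicalPhysics.QuantumFieldTheory.Balaban1983to89.T4ReTrLipUnitary
import HarnessLib

/-!
# `AlphaInputsT3ACv3PerturbedPlaquetteFrame` — STRATEGY B for 2′, the (FL) row under OWNER RULING g24-№4: **THE COVARIANT CURL IN A FRAME** — gauge covariance of the covariant curl
# of `…v3PerturbedPlaquette`, and its comparison with the FLAT curl `a₁ + a₂ − a₃ − a₄` at a near-flat background — lane `pub-balaban3d` ∕ cell `ym3-torus`, seat `ym-ust-19936-w4` (g0)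

WHY (memo `NEWTON-FL-FRAMES-w4-g0.md` §1–§2; companion of `…CovLinAvgFrame` on the plaquette side).  In the Newton assembly the correction is `a = R u`, built blockwise as
`Ad(g_β)⁻¹·liftS(û)` in a stencil gauge `g_β` that flattens the start `U₀`; its plaquette cost is read by `PerturbedPlaquette.dist1_plaqHol_perturb_le` through the COVARIANT curl
`D_{U₀}a(p) = a₁ + U₁a₂U₁* − G a₃ G* − W a₄ W*`.  To use the (LL) engine's FLAT curl bound (`curlAt_liftS = S2 ∘ curl`, w3's `norm_curlM_liftSCLM_le`) one needs:
* §1 ★ `covCurl_conj_eq` ∕ `covCurl_gaugeAct_eq` — EXACT GAUGE COVARIANCE: `D_{U^g}(a^g)(p) = g(x)·D_U(a)(p)·g(x)*` for `a^g_b = g(b₋)a_b g(b₋)*` (`x = p.src`); the transports of the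
  gauged field are `g(x)U₁g(x₁)⁻¹`, `g(x)Gg(x₂)⁻¹`, `g(x)Wg(x)⁻¹` (`transport_gaugeAct`, `T4ReTrLipUnitary.plaqHol_gaugeAct`).
* §2 ★ `norm_covCurl_sub_flatCurl_le` — NEAR-FLAT COMPARISON: `‖D_U a(p) − (a₁ + a₂ − a₃ − a₄)‖ ≤ 2(‖U₁−1‖·‖a₂‖ + ‖G−1‖·‖a₃‖ + ‖W−1‖·‖a₄‖)`, and with `‖U_{bᵢ} − 1‖ ≤ η` on the three
  transporting bonds, `‖G − 1‖ ≤ 3η`, `‖W − 1‖ ≤ 4η`: `≤ 16ηδ` (`norm_transport_sub_one_le`).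
* §3 ★★ `norm_covCurl_sub_conj_flatCurl_le` — THE PLAQUETTE FRAME LETTER: for ANY gauge `g` with `U^g` η-flat on the bonds of `p`, `‖D_U a(p) − g(x)*·[flat curl of a^g](p)·g(x)‖ ≤ 16η·δ`
  (`‖a_b‖ ≤ δ` on p's bonds) — so `dist1((e^{a}U)(∂p)) ≤ dist1 U(∂p) + ‖flat curl of a^g (p)‖ + 16ηδ + (e^{4δ}−1−4δ)` (`dist1_plaqHol_perturb_le_frame`).
Count-neutral helper toward R3 2′ (items 19936∕19935); `hLift`∕(FL) NOT proved here; registry untouched; nothing about d = 4, the continuum, or a mass gap; YM₃ on T³ is rung R3, not Clay.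

References: T. Bałaban, Commun. Math. Phys. 98 (1985) 17–51 [Balaban1985Averaging] ((8)–(9) pp.18–19, (19) p.21).
-/

set_option autoImplicit false

noncomputable section

open scoped Matrix.Norms.L2Operator
open NormedSpace

namespace Summit.QuantumFields.YangMills.Theorems.PerturbedPlaquetteFrame

open Literature.MathematicalPhysics.QuantumFieldTheory.Balaban1983to89
open Summit.QuantumFields.YangMills.Theorems.PerturbedPlaquette (dist1_SU_eq norm_conj_SU dist1_plaqHol_perturb_le)
open Summit.QuantumFields.YangMills.Theorems.Prop7HolRatioPerStep (coe_star_mul_self coe_mul_star_self)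
open Summit.QuantumFields.YangMills.Theorems.Prop7CovariantCoercivity (norm_conj_sub_self_le')
open Summit.QuantumFields.YangMills.Theorems.CovLinAvgFrame (coe_gaugeAct)

variable {n : Type*} [Fintype n] [DecidableEq n] {P : Params} {j : ℕ}

/-! ## §1 Gauge covariance of the covariant curl -/

/-- **THE MATRIX IDENTITY BEHIND GAUGE COVARIANCE**: for `g₀, g₁, g₂ ∈ SU(n)` (the gauge at `x`, `x+e_μ`, `x+e_ν`) and any `U₁, G, W, a₁, …, a₄`,
`g₀a₁g₀* + (g₀U₁g₁*)(g₁a₂g₁*)(g₀U₁g₁*)* − (g₀Gg₂*)(g₂a₃g₂*)(g₀Gg₂*)* − (g₀Wg₀*)(g₀a₄g₀*)(g₀Wg₀*)* = g₀·[a₁ + U₁a₂U₁* − Ga₃G* − Wa₄W*]·g₀*`. [cite: Balaban1985Averaging, (8)–(9) p.19] -/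
theorem covCurl_conj_eq (g₀ g₁ g₂ : Matrix.specialUnitaryGroup n ℂ) (U₁ G W a₁ a₂ a₃ a₄ : Matrix n n ℂ) :
    (g₀ : Matrix n n ℂ) * a₁ * star (g₀ : Matrix n n ℂ) +
        ((g₀ : Matrix n n ℂ) * U₁ * star (g₁ : Matrix n n ℂ)) * ((g₁ : Matrix n n ℂ) * a₂ * star (g₁ : Matrix n n ℂ)) * star ((g₀ : Matrix n n ℂ) * U₁ * star (g₁ : Matrix n n ℂ)) -
        ((g₀ : Matrix n n ℂ) * G * star (g₂ : Matrix n n ℂ)) * ((g₂ : Matrix n n ℂ) * a₃ * star (g₂ : Matrix n n ℂ)) * star ((g₀ : Matrix n n ℂ) * G * star (g₂ : Matrix n n ℂ)) -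
        ((g₀ : Matrix n n ℂ) * W * star (g₀ : Matrix n n ℂ)) * ((g₀ : Matrix n n ℂ) * a₄ * star (g₀ : Matrix n n ℂ)) * star ((g₀ : Matrix n n ℂ) * W * star (g₀ : Matrix n n ℂ)) =
      (g₀ : Matrix n n ℂ) * (a₁ + U₁ * a₂ * star U₁ - G * a₃ * star G - W * a₄ * star W) * star (g₀ : Matrix n n ℂ) := by
  simp only [star_mul, star_star]
  have t2 : (g₀ : Matrix n n ℂ) * U₁ * star (g₁ : Matrix n n ℂ) * ((g₁ : Matrix n n ℂ) * a₂ * star (g₁ : Matrix n n ℂ)) *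
        ((g₁ : Matrix n n ℂ) * (star U₁ * star (g₀ : Matrix n n ℂ))) = (g₀ : Matrix n n ℂ) * (U₁ * a₂ * star U₁) * star (g₀ : Matrix n n ℂ) := by
    calc _ = (g₀ : Matrix n n ℂ) * U₁ * (star (g₁ : Matrix n n ℂ) * (g₁ : Matrix n n ℂ)) * a₂ * (star (g₁ : Matrix n n ℂ) * (g₁ : Matrix n n ℂ)) * star U₁ * star (g₀ : Matrix n n ℂ) := by
          noncomm_ring
      _ = _ := by rw [coe_star_mul_self]; noncomm_ring
  have t3 : (g₀ : Matrix n n ℂ) * G * star (g₂ : Matrix n n ℂ) * ((g₂ : Matrix n n ℂ) * a₃ * star (g₂ : Matrix n n ℂ)) *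
        ((g₂ : Matrix n n ℂ) * (star G * star (g₀ : Matrix n n ℂ))) = (g₀ : Matrix n n ℂ) * (G * a₃ * star G) * star (g₀ : Matrix n n ℂ) := by
    calc _ = (g₀ : Matrix n n ℂ) * G * (star (g₂ : Matrix n n ℂ) * (g₂ : Matrix n n ℂ)) * a₃ * (star (g₂ : Matrix n n ℂ) * (g₂ : Matrix n n ℂ)) * star G * star (g₀ : Matrix n n ℂ) := by
          noncomm_ring
      _ = _ := by rw [coe_star_mul_self]; noncomm_ring
  have t4 : (g₀ : Matrix n n ℂ) * W * star (g₀ : Matrix n n ℂ) * ((g₀ : Matrix n n ℂ) * a₄ * star (g₀ : Matrix n n ℂ)) *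
        ((g₀ : Matrix n n ℂ) * (star W * star (g₀ : Matrix n n ℂ))) = (g₀ : Matrix n n ℂ) * (W * a₄ * star W) * star (g₀ : Matrix n n ℂ) := by
    calc _ = (g₀ : Matrix n n ℂ) * W * (star (g₀ : Matrix n n ℂ) * (g₀ : Matrix n n ℂ)) * a₄ * (star (g₀ : Matrix n n ℂ) * (g₀ : Matrix n n ℂ)) * star W * star (g₀ : Matrix n n ℂ) := by
          noncomm_ring
      _ = _ := by rw [coe_star_mul_self]; noncomm_ring
  rw [t2, t3, t4]
  noncomm_ring

variable [Nonempty n]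

/-- **THE TRANSPORTS OF A GAUGE-TRANSFORMED FIELD** (group level): `(U^g)₁ = g(x)U₁g(x₁)⁻¹`, `G^g = g(x)·G·g(x₂)⁻¹` (`G = U₁U₂U₃⁻¹`, `x₂ = x + e_ν`), `W^g = g(x)Wg(x)⁻¹`.
[cite: Balaban1985Averaging, (8)–(9) p.19] -/
theorem transport_gaugeAct (g : GaugeTransf P j (Matrix.specialUnitaryGroup n ℂ)) (U : GaugeField P j (Matrix.specialUnitaryGroup n ℂ)) (p : Plaq P j) :
    GaugeField.gaugeAct g U ⟨p.src, p.μ⟩ = g p.src * U ⟨p.src, p.μ⟩ * (g (p.src.shift p.μ))⁻¹ ∧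
    GaugeField.gaugeAct g U ⟨p.src, p.μ⟩ * GaugeField.gaugeAct g U ⟨p.src.shift p.μ, p.ν⟩ * (GaugeField.gaugeAct g U ⟨p.src.shift p.ν, p.μ⟩)⁻¹ =
      g p.src * (U ⟨p.src, p.μ⟩ * U ⟨p.src.shift p.μ, p.ν⟩ * (U ⟨p.src.shift p.ν, p.μ⟩)⁻¹) * (g (p.src.shift p.ν))⁻¹ ∧
    GaugeField.plaqHol (GaugeField.gaugeAct g U) p = g p.src * GaugeField.plaqHol U p * (g p.src)⁻¹ := by
  refine ⟨rfl, ?_, T4ReTrLipUnitary.plaqHol_gaugeAct g U p⟩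
  simp only [GaugeField.gaugeAct, PBond.tgt, Site.shift_comm p.src p.ν p.μ]
  group

/-- **★ GAUGE COVARIANCE OF THE COVARIANT CURL** (exact): for the gauged background `U^g` and the conjugated perturbation `a^g_b = g(b₋)a_b g(b₋)*`,
`D_{U^g}(a^g)(p) = g(x)·D_U(a)(p)·g(x)*`, `x = p.src`. [cite: Balaban1985Averaging, (8)–(9) p.19] -/
theorem covCurl_gaugeAct_eq (g : GaugeTransf P j (Matrix.specialUnitaryGroup n ℂ)) (U : GaugeField P j (Matrix.specialUnitaryGroup n ℂ)) (a : PBond P j → Matrix n n ℂ)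
    (p : Plaq P j) :
    (g p.src : Matrix n n ℂ) * a ⟨p.src, p.μ⟩ * star (g p.src : Matrix n n ℂ) +
        ((GaugeField.gaugeAct g U ⟨p.src, p.μ⟩ : Matrix.specialUnitaryGroup n ℂ) : Matrix n n ℂ) * ((g (p.src.shift p.μ) : Matrix n n ℂ) * a ⟨p.src.shift p.μ, p.ν⟩ * star (g (p.src.shift p.μ) : Matrix n n ℂ)) *
          star ((GaugeField.gaugeAct g U ⟨p.src, p.μ⟩ : Matrix.specialUnitaryGroup n ℂ) : Matrix n n ℂ) -
        ((GaugeField.gaugeAct g U ⟨p.src, p.μ⟩ * GaugeField.gaugeAct g U ⟨p.src.shift p.μ, p.ν⟩ * (GaugeField.gaugeAct g U ⟨p.src.shift p.ν, p.μ⟩)⁻¹ :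
            Matrix.specialUnitaryGroup n ℂ) : Matrix n n ℂ) *
          ((g (p.src.shift p.ν) : Matrix n n ℂ) * a ⟨p.src.shift p.ν, p.μ⟩ * star (g (p.src.shift p.ν) : Matrix n n ℂ)) *
          star ((GaugeField.gaugeAct g U ⟨p.src, p.μ⟩ * GaugeField.gaugeAct g U ⟨p.src.shift p.μ, p.ν⟩ * (GaugeField.gaugeAct g U ⟨p.src.shift p.ν, p.μ⟩)⁻¹ :
            Matrix.specialUnitaryGroup n ℂ) : Matrix n n ℂ) -
        ((GaugeField.plaqHol (GaugeField.gaugeAct g U) p : Matrix.specialUnitaryGroup n ℂ) : Matrix n n ℂ) * ((g p.src : Matrix n n ℂ) * a ⟨p.src, p.ν⟩ * star (g p.src : Matrix n n ℂ)) *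
          star ((GaugeField.plaqHol (GaugeField.gaugeAct g U) p : Matrix.specialUnitaryGroup n ℂ) : Matrix n n ℂ) =
      (g p.src : Matrix n n ℂ) *
        (a ⟨p.src, p.μ⟩ + (U ⟨p.src, p.μ⟩ : Matrix n n ℂ) * a ⟨p.src.shift p.μ, p.ν⟩ * star (U ⟨p.src, p.μ⟩ : Matrix n n ℂ) -
          ((U ⟨p.src, p.μ⟩ * U ⟨p.src.shift p.μ, p.ν⟩ * (U ⟨p.src.shift p.ν, p.μ⟩)⁻¹ : Matrix.specialUnitaryGroup n ℂ) : Matrix n n ℂ) * a ⟨p.src.shift p.ν, p.μ⟩ *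
            star ((U ⟨p.src, p.μ⟩ * U ⟨p.src.shift p.μ, p.ν⟩ * (U ⟨p.src.shift p.ν, p.μ⟩)⁻¹ : Matrix.specialUnitaryGroup n ℂ) : Matrix n n ℂ) -
          ((GaugeField.plaqHol U p : Matrix.specialUnitaryGroup n ℂ) : Matrix n n ℂ) * a ⟨p.src, p.ν⟩ * star ((GaugeField.plaqHol U p : Matrix.specialUnitaryGroup n ℂ) : Matrix n n ℂ)) *
        star (g p.src : Matrix n n ℂ) := by
  obtain ⟨h1, h2, h3⟩ := transport_gaugeAct g U p
  rw [h2, h3, h1]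
  simp only [Submonoid.coe_mul]
  have i1 : (((g (p.src.shift p.μ))⁻¹ : Matrix.specialUnitaryGroup n ℂ) : Matrix n n ℂ) = star (g (p.src.shift p.μ) : Matrix n n ℂ) := rfl
  have i2 : (((g (p.src.shift p.ν))⁻¹ : Matrix.specialUnitaryGroup n ℂ) : Matrix n n ℂ) = star (g (p.src.shift p.ν) : Matrix n n ℂ) := rfl
  have i0 : (((g p.src)⁻¹ : Matrix.specialUnitaryGroup n ℂ) : Matrix n n ℂ) = star (g p.src : Matrix n n ℂ) := rfl
  rw [i1, i2, i0]
  exact covCurl_conj_eq (g p.src) (g (p.src.shift p.μ)) (g (p.src.shift p.ν)) _ _ _ _ _ _ _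

/-! ## §2 Near-flat comparison with the flat curl -/

omit [Nonempty n] in
/-- **THE COVARIANT CURL AT A NEAR-FLAT BACKGROUND IS THE FLAT CURL**: `‖D_U a(p) − (a₁ + a₂ − a₃ − a₄)‖ ≤ 2(‖U₁−1‖‖a₂‖ + ‖G−1‖‖a₃‖ + ‖W−1‖‖a₄‖)` for the transports
`U₁, G, W ∈ SU(n)`. [cite: Balaban1985Averaging, (9) p.19, (19) p.21] -/
theorem norm_covCurl_sub_flatCurl_le (U₁ G W : Matrix.specialUnitaryGroup n ℂ) (a₁ a₂ a₃ a₄ : Matrix n n ℂ) :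
    ‖(a₁ + (U₁ : Matrix n n ℂ) * a₂ * star (U₁ : Matrix n n ℂ) - (G : Matrix n n ℂ) * a₃ * star (G : Matrix n n ℂ) - (W : Matrix n n ℂ) * a₄ * star (W : Matrix n n ℂ)) -
        (a₁ + a₂ - a₃ - a₄)‖ ≤
      2 * (‖(U₁ : Matrix n n ℂ) - 1‖ * ‖a₂‖ + ‖(G : Matrix n n ℂ) - 1‖ * ‖a₃‖ + ‖(W : Matrix n n ℂ) - 1‖ * ‖a₄‖) := by
  have e : (a₁ + (U₁ : Matrix n n ℂ) * a₂ * star (U₁ : Matrix n n ℂ) - (G : Matrix n n ℂ) * a₃ * star (G : Matrix n n ℂ) - (W : Matrix n n ℂ) * a₄ * star (W : Matrix n n ℂ)) -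
        (a₁ + a₂ - a₃ - a₄) =
      ((U₁ : Matrix n n ℂ) * a₂ * star (U₁ : Matrix n n ℂ) - a₂) - ((G : Matrix n n ℂ) * a₃ * star (G : Matrix n n ℂ) - a₃) - ((W : Matrix n n ℂ) * a₄ * star (W : Matrix n n ℂ) - a₄) := by
    abel
  rw [e]
  calc _ ≤ ‖(U₁ : Matrix n n ℂ) * a₂ * star (U₁ : Matrix n n ℂ) - a₂‖ + ‖(G : Matrix n n ℂ) * a₃ * star (G : Matrix n n ℂ) - a₃‖ + ‖(W : Matrix n n ℂ) * a₄ * star (W : Matrix n n ℂ) - a₄‖ :=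
        (norm_sub_le _ _).trans (add_le_add (norm_sub_le _ _) le_rfl)
    _ ≤ 2 * ‖(U₁ : Matrix n n ℂ) - 1‖ * ‖a₂‖ + 2 * ‖(G : Matrix n n ℂ) - 1‖ * ‖a₃‖ + 2 * ‖(W : Matrix n n ℂ) - 1‖ * ‖a₄‖ :=
        add_le_add (add_le_add (norm_conj_sub_self_le' _ _) (norm_conj_sub_self_le' _ _)) (norm_conj_sub_self_le' _ _)
    _ = _ := by ring

/-- **SIZES OF THE TRANSPORTS FROM THE BONDS**: if `‖U_{b₁} − 1‖, ‖U_{b₂} − 1‖, ‖U_{b₃} − 1‖ ≤ η` (the three transporting bonds of `p`; `U_{b₄}` enters only through `W`), then `‖G − 1‖ ≤ 3η` and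
`‖W − 1‖ ≤ 4η` given also `‖U_{b₄} − 1‖ ≤ η` (`dist1_mul_le`, `dist1_inv`). [cite: Balaban1985Averaging, (19)–(20) p.21] -/
theorem norm_transport_sub_one_le (U : GaugeField P j (Matrix.specialUnitaryGroup n ℂ)) (p : Plaq P j) {η : ℝ}
    (h₁ : ‖(U ⟨p.src, p.μ⟩ : Matrix n n ℂ) - 1‖ ≤ η) (h₂ : ‖(U ⟨p.src.shift p.μ, p.ν⟩ : Matrix n n ℂ) - 1‖ ≤ η) (h₃ : ‖(U ⟨p.src.shift p.ν, p.μ⟩ : Matrix n n ℂ) - 1‖ ≤ η)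
    (h₄ : ‖(U ⟨p.src, p.ν⟩ : Matrix n n ℂ) - 1‖ ≤ η) :
    ‖((U ⟨p.src, p.μ⟩ * U ⟨p.src.shift p.μ, p.ν⟩ * (U ⟨p.src.shift p.ν, p.μ⟩)⁻¹ : Matrix.specialUnitaryGroup n ℂ) : Matrix n n ℂ) - 1‖ ≤ 3 * η ∧
      ‖((GaugeField.plaqHol U p : Matrix.specialUnitaryGroup n ℂ) : Matrix n n ℂ) - 1‖ ≤ 4 * η := by
  rw [← dist1_SU_eq] at h₁ h₂ h₃ h₄ ⊢
  rw [← dist1_SU_eq]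
  have hG : GaugeGroup.dist1 (U ⟨p.src, p.μ⟩ * U ⟨p.src.shift p.μ, p.ν⟩ * (U ⟨p.src.shift p.ν, p.μ⟩)⁻¹) ≤ 3 * η := by
    calc _ ≤ GaugeGroup.dist1 (U ⟨p.src, p.μ⟩ * U ⟨p.src.shift p.μ, p.ν⟩) + GaugeGroup.dist1 ((U ⟨p.src.shift p.ν, p.μ⟩)⁻¹) := GaugeGroup.dist1_mul_le _ _
      _ ≤ (GaugeGroup.dist1 (U ⟨p.src, p.μ⟩) + GaugeGroup.dist1 (U ⟨p.src.shift p.μ, p.ν⟩)) + GaugeGroup.dist1 (U ⟨p.src.shift p.ν, p.μ⟩) := by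
          rw [GaugeGroup.dist1_inv]; exact add_le_add (GaugeGroup.dist1_mul_le _ _) le_rfl
      _ ≤ (η + η) + η := by gcongr
      _ = 3 * η := by ring
  refine ⟨hG, ?_⟩
  calc GaugeGroup.dist1 (GaugeField.plaqHol U p)
      = GaugeGroup.dist1 (U ⟨p.src, p.μ⟩ * U ⟨p.src.shift p.μ, p.ν⟩ * (U ⟨p.src.shift p.ν, p.μ⟩)⁻¹ * (U ⟨p.src, p.ν⟩)⁻¹) := rfl
    _ ≤ GaugeGroup.dist1 (U ⟨p.src, p.μ⟩ * U ⟨p.src.shift p.μ, p.ν⟩ * (U ⟨p.src.shift p.ν, p.μ⟩)⁻¹) + GaugeGroup.dist1 ((U ⟨p.src, p.ν⟩)⁻¹) := GaugeGroup.dist1_mul_le _ _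
    _ ≤ 3 * η + η := by rw [GaugeGroup.dist1_inv]; exact add_le_add hG h₄
    _ = 4 * η := by ring

/-- **THE η-FORM**: with `‖U_{bᵢ} − 1‖ ≤ η` on the four bonds of `p` and `‖a_{bᵢ}‖ ≤ δ`, `‖D_U a(p) − (a₁ + a₂ − a₃ − a₄)‖ ≤ 16ηδ`. [cite: Balaban1985Averaging, (9) p.19, (19) p.21] -/
theorem norm_covCurl_sub_flatCurl_le_eta (U : GaugeField P j (Matrix.specialUnitaryGroup n ℂ)) (a : PBond P j → Matrix n n ℂ) (p : Plaq P j) {η δ : ℝ}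
    (h₁ : ‖(U ⟨p.src, p.μ⟩ : Matrix n n ℂ) - 1‖ ≤ η) (h₂ : ‖(U ⟨p.src.shift p.μ, p.ν⟩ : Matrix n n ℂ) - 1‖ ≤ η) (h₃ : ‖(U ⟨p.src.shift p.ν, p.μ⟩ : Matrix n n ℂ) - 1‖ ≤ η)
    (h₄ : ‖(U ⟨p.src, p.ν⟩ : Matrix n n ℂ) - 1‖ ≤ η)
    (ha₂ : ‖a ⟨p.src.shift p.μ, p.ν⟩‖ ≤ δ) (ha₃ : ‖a ⟨p.src.shift p.ν, p.μ⟩‖ ≤ δ) (ha₄ : ‖a ⟨p.src, p.ν⟩‖ ≤ δ) :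
    ‖(a ⟨p.src, p.μ⟩ + (U ⟨p.src, p.μ⟩ : Matrix n n ℂ) * a ⟨p.src.shift p.μ, p.ν⟩ * star (U ⟨p.src, p.μ⟩ : Matrix n n ℂ) -
          ((U ⟨p.src, p.μ⟩ * U ⟨p.src.shift p.μ, p.ν⟩ * (U ⟨p.src.shift p.ν, p.μ⟩)⁻¹ : Matrix.specialUnitaryGroup n ℂ) : Matrix n n ℂ) * a ⟨p.src.shift p.ν, p.μ⟩ *
            star ((U ⟨p.src, p.μ⟩ * U ⟨p.src.shift p.μ, p.ν⟩ * (U ⟨p.src.shift p.ν, p.μ⟩)⁻¹ : Matrix.specialUnitaryGroup n ℂ) : Matrix n n ℂ) -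
          ((GaugeField.plaqHol U p : Matrix.specialUnitaryGroup n ℂ) : Matrix n n ℂ) * a ⟨p.src, p.ν⟩ * star ((GaugeField.plaqHol U p : Matrix.specialUnitaryGroup n ℂ) : Matrix n n ℂ)) -
        (a ⟨p.src, p.μ⟩ + a ⟨p.src.shift p.μ, p.ν⟩ - a ⟨p.src.shift p.ν, p.μ⟩ - a ⟨p.src, p.ν⟩)‖ ≤ 16 * η * δ := by
  obtain ⟨hG, hW⟩ := norm_transport_sub_one_le U p h₁ h₂ h₃ h₄
  have hη : 0 ≤ η := (norm_nonneg _).trans h₁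
  have hδ : 0 ≤ δ := (norm_nonneg _).trans ha₂
  refine (norm_covCurl_sub_flatCurl_le _ _ _ _ _ _ _).trans ?_
  have e1 : ‖(U ⟨p.src, p.μ⟩ : Matrix n n ℂ) - 1‖ * ‖a ⟨p.src.shift p.μ, p.ν⟩‖ ≤ η * δ := mul_le_mul h₁ ha₂ (norm_nonneg _) hη
  have e2 : ‖((U ⟨p.src, p.μ⟩ * U ⟨p.src.shift p.μ, p.ν⟩ * (U ⟨p.src.shift p.ν, p.μ⟩)⁻¹ : Matrix.specialUnitaryGroup n ℂ) : Matrix n n ℂ) - 1‖ * ‖a ⟨p.src.shift p.ν, p.μ⟩‖ ≤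
      (3 * η) * δ := mul_le_mul hG ha₃ (norm_nonneg _) (by positivity)
  have e3 : ‖((GaugeField.plaqHol U p : Matrix.specialUnitaryGroup n ℂ) : Matrix n n ℂ) - 1‖ * ‖a ⟨p.src, p.ν⟩‖ ≤ (4 * η) * δ := mul_le_mul hW ha₄ (norm_nonneg _) (by positivity)
  nlinarith

/-! ## §3 The plaquette frame letter -/

/-- **★★ THE COVARIANT CURL IN A FRAME**: for ANY gauge `g` with `U^g` η-flat on the four bonds of `p` and `‖a_b‖ ≤ δ` there (b₂, b₃, b₄ suffice),
`‖D_U a(p) − g(x)*·[a^g₁ + a^g₂ − a^g₃ − a^g₄]·g(x)‖ ≤ 16ηδ`, `a^g_b = g(b₋)a_b g(b₋)*`, `x = p.src` — the covariant curl at an arbitrary background is the FLAT curl of the rotated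
perturbation read back at the base point, up to the flatness defect in the frame (§1 exact covariance + §2 at the gauged background). [cite: Balaban1985Averaging, (8)–(9) p.19, (19) p.21] -/
theorem norm_covCurl_sub_conj_flatCurl_le (g : GaugeTransf P j (Matrix.specialUnitaryGroup n ℂ)) (U : GaugeField P j (Matrix.specialUnitaryGroup n ℂ)) (a : PBond P j → Matrix n n ℂ)
    (p : Plaq P j) {η δ : ℝ}
    (h₁ : ‖((GaugeField.gaugeAct g U ⟨p.src, p.μ⟩ : Matrix.specialUnitaryGroup n ℂ) : Matrix n n ℂ) - 1‖ ≤ η) (h₂ : ‖((GaugeField.gaugeAct g U ⟨p.src.shift p.μ, p.ν⟩ : Matrix.specialUnitaryGroup n ℂ) : Matrix n n ℂ) - 1‖ ≤ η)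
    (h₃ : ‖((GaugeField.gaugeAct g U ⟨p.src.shift p.ν, p.μ⟩ : Matrix.specialUnitaryGroup n ℂ) : Matrix n n ℂ) - 1‖ ≤ η) (h₄ : ‖((GaugeField.gaugeAct g U ⟨p.src, p.ν⟩ : Matrix.specialUnitaryGroup n ℂ) : Matrix n n ℂ) - 1‖ ≤ η)
    (ha₂ : ‖a ⟨p.src.shift p.μ, p.ν⟩‖ ≤ δ) (ha₃ : ‖a ⟨p.src.shift p.ν, p.μ⟩‖ ≤ δ) (ha₄ : ‖a ⟨p.src, p.ν⟩‖ ≤ δ) :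
    ‖(a ⟨p.src, p.μ⟩ + (U ⟨p.src, p.μ⟩ : Matrix n n ℂ) * a ⟨p.src.shift p.μ, p.ν⟩ * star (U ⟨p.src, p.μ⟩ : Matrix n n ℂ) -
          ((U ⟨p.src, p.μ⟩ * U ⟨p.src.shift p.μ, p.ν⟩ * (U ⟨p.src.shift p.ν, p.μ⟩)⁻¹ : Matrix.specialUnitaryGroup n ℂ) : Matrix n n ℂ) * a ⟨p.src.shift p.ν, p.μ⟩ *
            star ((U ⟨p.src, p.μ⟩ * U ⟨p.src.shift p.μ, p.ν⟩ * (U ⟨p.src.shift p.ν, p.μ⟩)⁻¹ : Matrix.specialUnitaryGroup n ℂ) : Matrix n n ℂ) -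
          ((GaugeField.plaqHol U p : Matrix.specialUnitaryGroup n ℂ) : Matrix n n ℂ) * a ⟨p.src, p.ν⟩ * star ((GaugeField.plaqHol U p : Matrix.specialUnitaryGroup n ℂ) : Matrix n n ℂ)) -
        star (g p.src : Matrix n n ℂ) *
          ((g p.src : Matrix n n ℂ) * a ⟨p.src, p.μ⟩ * star (g p.src : Matrix n n ℂ) +
            (g (p.src.shift p.μ) : Matrix n n ℂ) * a ⟨p.src.shift p.μ, p.ν⟩ * star (g (p.src.shift p.μ) : Matrix n n ℂ) -
            (g (p.src.shift p.ν) : Matrix n n ℂ) * a ⟨p.src.shift p.ν, p.μ⟩ * star (g (p.src.shift p.ν) : Matrix n n ℂ) -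
            (g p.src : Matrix n n ℂ) * a ⟨p.src, p.ν⟩ * star (g p.src : Matrix n n ℂ)) * (g p.src : Matrix n n ℂ)‖ ≤ 16 * η * δ := by
  -- the covariant curl of the rotated perturbation at the gauged background, compared with its flat curl
  set ag : PBond P j → Matrix n n ℂ := fun b => (g b.src : Matrix n n ℂ) * a b * star (g b.src : Matrix n n ℂ) with hag
  have hag₂ : ‖ag ⟨p.src.shift p.μ, p.ν⟩‖ ≤ δ := by rw [hag]; dsimp only; rw [norm_conj_SU]; exact ha₂
  have hag₃ : ‖ag ⟨p.src.shift p.ν, p.μ⟩‖ ≤ δ := by rw [hag]; dsimp only; rw [norm_conj_SU]; exact ha₃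
  have hag₄ : ‖ag ⟨p.src, p.ν⟩‖ ≤ δ := by rw [hag]; dsimp only; rw [norm_conj_SU]; exact ha₄
  have hflat := norm_covCurl_sub_flatCurl_le_eta (GaugeField.gaugeAct g U) ag p h₁ h₂ h₃ h₄ hag₂ hag₃ hag₄
  have hcov := covCurl_gaugeAct_eq g U a p
  -- `D_{U^g}(a^g) = g₀ D_U(a) g₀*`; conjugate the comparison back by `g₀*`
  set g₀ := (g p.src : Matrix n n ℂ) with hg₀
  set D := a ⟨p.src, p.μ⟩ + (U ⟨p.src, p.μ⟩ : Matrix n n ℂ) * a ⟨p.src.shift p.μ, p.ν⟩ * star (U ⟨p.src, p.μ⟩ : Matrix n n ℂ) -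
          ((U ⟨p.src, p.μ⟩ * U ⟨p.src.shift p.μ, p.ν⟩ * (U ⟨p.src.shift p.ν, p.μ⟩)⁻¹ : Matrix.specialUnitaryGroup n ℂ) : Matrix n n ℂ) * a ⟨p.src.shift p.ν, p.μ⟩ *
            star ((U ⟨p.src, p.μ⟩ * U ⟨p.src.shift p.μ, p.ν⟩ * (U ⟨p.src.shift p.ν, p.μ⟩)⁻¹ : Matrix.specialUnitaryGroup n ℂ) : Matrix n n ℂ) -
          ((GaugeField.plaqHol U p : Matrix.specialUnitaryGroup n ℂ) : Matrix n n ℂ) * a ⟨p.src, p.ν⟩ * star ((GaugeField.plaqHol U p : Matrix.specialUnitaryGroup n ℂ) : Matrix n n ℂ)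
    with hD
  set F := ag ⟨p.src, p.μ⟩ + ag ⟨p.src.shift p.μ, p.ν⟩ - ag ⟨p.src.shift p.ν, p.μ⟩ - ag ⟨p.src, p.ν⟩ with hF
  have hcov' : ag ⟨p.src, p.μ⟩ + ((GaugeField.gaugeAct g U ⟨p.src, p.μ⟩ : Matrix.specialUnitaryGroup n ℂ) : Matrix n n ℂ) * ag ⟨p.src.shift p.μ, p.ν⟩ * star ((GaugeField.gaugeAct g U ⟨p.src, p.μ⟩ : Matrix.specialUnitaryGroup n ℂ) : Matrix n n ℂ) -
        ((GaugeField.gaugeAct g U ⟨p.src, p.μ⟩ * GaugeField.gaugeAct g U ⟨p.src.shift p.μ, p.ν⟩ * (GaugeField.gaugeAct g U ⟨p.src.shift p.ν, p.μ⟩)⁻¹ :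
            Matrix.specialUnitaryGroup n ℂ) : Matrix n n ℂ) * ag ⟨p.src.shift p.ν, p.μ⟩ *
          star ((GaugeField.gaugeAct g U ⟨p.src, p.μ⟩ * GaugeField.gaugeAct g U ⟨p.src.shift p.μ, p.ν⟩ * (GaugeField.gaugeAct g U ⟨p.src.shift p.ν, p.μ⟩)⁻¹ :
            Matrix.specialUnitaryGroup n ℂ) : Matrix n n ℂ) -
        ((GaugeField.plaqHol (GaugeField.gaugeAct g U) p : Matrix.specialUnitaryGroup n ℂ) : Matrix n n ℂ) * ag ⟨p.src, p.ν⟩ *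
          star ((GaugeField.plaqHol (GaugeField.gaugeAct g U) p : Matrix.specialUnitaryGroup n ℂ) : Matrix n n ℂ) = g₀ * D * star g₀ := by
    rw [hag, hD, hg₀]; exact hcov
  rw [hcov'] at hflat
  -- `D − g₀* F g₀ = g₀* (g₀ D g₀* − F) g₀`
  have e : star g₀ * (g₀ * D * star g₀ - F) * g₀ = D - star g₀ * F * g₀ := by
    calc star g₀ * (g₀ * D * star g₀ - F) * g₀ = (star g₀ * g₀) * D * (star g₀ * g₀) - star g₀ * F * g₀ := by noncomm_ring
      _ = D - star g₀ * F * g₀ := by rw [coe_star_mul_self, one_mul, mul_one]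
  rw [← e, CStarRing.norm_mul_mem_unitary _ (g p.src).2.1, CStarRing.norm_mem_unitary_mul _ (Unitary.star_mem (g p.src).2.1)]
  exact hflat

/-- **★★ THE PLAQUETTE LEDGER IN A FRAME**: `dist1((e^{a}U)(∂p)) ≤ dist1 U(∂p) + ‖a^g₁ + a^g₂ − a^g₃ − a^g₄‖ + 16ηδ + (e^{4δ}−1−4δ)` for `U′_b = e^{a_b}U_b` (`a_b* = −a_b`, `‖a_b‖ ≤ δ` on p's bonds)
and ANY gauge `g` with `U^g` η-flat on p's bonds: the plaquette cost of a correction built in a stencil gauge is its FLAT curl there (the (LL) engine's `S2 ∘ curl` bound) plus the frame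
term. [cite: Balaban1985Averaging, (8)–(9) p.19, (19) p.21] -/
theorem dist1_plaqHol_perturb_le_frame (g : GaugeTransf P j (Matrix.specialUnitaryGroup n ℂ)) (U U' : GaugeField P j (Matrix.specialUnitaryGroup n ℂ)) (a : PBond P j → Matrix n n ℂ)
    (hstar : ∀ b, star (a b) = -a b) (hU' : ∀ b, ((U' b : Matrix.specialUnitaryGroup n ℂ) : Matrix n n ℂ) = exp (a b) * (U b : Matrix n n ℂ))
    (p : Plaq P j) {η δ : ℝ}
    (h₁ : ‖((GaugeField.gaugeAct g U ⟨p.src, p.μ⟩ : Matrix.specialUnitaryGroup n ℂ) : Matrix n n ℂ) - 1‖ ≤ η) (h₂ : ‖((GaugeField.gaugeAct g U ⟨p.src.shift p.μ, p.ν⟩ : Matrix.specialUnitaryGroup n ℂ) : Matrix n n ℂ) - 1‖ ≤ η)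
    (h₃ : ‖((GaugeField.gaugeAct g U ⟨p.src.shift p.ν, p.μ⟩ : Matrix.specialUnitaryGroup n ℂ) : Matrix n n ℂ) - 1‖ ≤ η) (h₄ : ‖((GaugeField.gaugeAct g U ⟨p.src, p.ν⟩ : Matrix.specialUnitaryGroup n ℂ) : Matrix n n ℂ) - 1‖ ≤ η)
    (ha₁ : ‖a ⟨p.src, p.μ⟩‖ ≤ δ) (ha₂ : ‖a ⟨p.src.shift p.μ, p.ν⟩‖ ≤ δ) (ha₃ : ‖a ⟨p.src.shift p.ν, p.μ⟩‖ ≤ δ) (ha₄ : ‖a ⟨p.src, p.ν⟩‖ ≤ δ) :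
    GaugeGroup.dist1 (GaugeField.plaqHol U' p) ≤ GaugeGroup.dist1 (GaugeField.plaqHol U p) +
      ‖(g p.src : Matrix n n ℂ) * a ⟨p.src, p.μ⟩ * star (g p.src : Matrix n n ℂ) +
          (g (p.src.shift p.μ) : Matrix n n ℂ) * a ⟨p.src.shift p.μ, p.ν⟩ * star (g (p.src.shift p.μ) : Matrix n n ℂ) -
          (g (p.src.shift p.ν) : Matrix n n ℂ) * a ⟨p.src.shift p.ν, p.μ⟩ * star (g (p.src.shift p.ν) : Matrix n n ℂ) -
          (g p.src : Matrix n n ℂ) * a ⟨p.src, p.ν⟩ * star (g p.src : Matrix n n ℂ)‖ +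
      16 * η * δ + (Real.exp (4 * δ) - 1 - 4 * δ) := by
  have hP := dist1_plaqHol_perturb_le U U' a hstar hU' p ha₁ ha₂ ha₃ ha₄
  have hF := norm_covCurl_sub_conj_flatCurl_le g U a p h₁ h₂ h₃ h₄ ha₂ ha₃ ha₄
  set g₀ := (g p.src : Matrix n n ℂ) with hg₀
  set F := (g p.src : Matrix n n ℂ) * a ⟨p.src, p.μ⟩ * star (g p.src : Matrix n n ℂ) +
          (g (p.src.shift p.μ) : Matrix n n ℂ) * a ⟨p.src.shift p.μ, p.ν⟩ * star (g (p.src.shift p.μ) : Matrix n n ℂ) -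
          (g (p.src.shift p.ν) : Matrix n n ℂ) * a ⟨p.src.shift p.ν, p.μ⟩ * star (g (p.src.shift p.ν) : Matrix n n ℂ) -
          (g p.src : Matrix n n ℂ) * a ⟨p.src, p.ν⟩ * star (g p.src : Matrix n n ℂ) with hFdef
  have hnF : ‖star g₀ * F * g₀‖ = ‖F‖ := by
    rw [CStarRing.norm_mul_mem_unitary _ (g p.src).2.1, CStarRing.norm_mem_unitary_mul _ (Unitary.star_mem (g p.src).2.1)]
  have key := norm_le_insert'
    (a ⟨p.src, p.μ⟩ + (U ⟨p.src, p.μ⟩ : Matrix n n ℂ) * a ⟨p.src.shift p.μ, p.ν⟩ * star (U ⟨p.src, p.μ⟩ : Matrix n n ℂ) -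
          ((U ⟨p.src, p.μ⟩ * U ⟨p.src.shift p.μ, p.ν⟩ * (U ⟨p.src.shift p.ν, p.μ⟩)⁻¹ : Matrix.specialUnitaryGroup n ℂ) : Matrix n n ℂ) * a ⟨p.src.shift p.ν, p.μ⟩ *
            star ((U ⟨p.src, p.μ⟩ * U ⟨p.src.shift p.μ, p.ν⟩ * (U ⟨p.src.shift p.ν, p.μ⟩)⁻¹ : Matrix.specialUnitaryGroup n ℂ) : Matrix n n ℂ) -
          ((GaugeField.plaqHol U p : Matrix.specialUnitaryGroup n ℂ) : Matrix n n ℂ) * a ⟨p.src, p.ν⟩ * star ((GaugeField.plaqHol U p : Matrix.specialUnitaryGroup n ℂ) : Matrix n n ℂ))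
    (star g₀ * F * g₀)
  rw [hnF] at key
  linarith

end Summit.QuantumFields.YangMills.Theorems.PerturbedPlaquetteFrame

end
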